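import Mathlib
import HarnessLib
import Summits.ResolutionOfSingularities.ResolutionOfSingularities.Theorems.WildQuotientsWildQuotientResolutionTerminalBlowupSpec
import Summits.ResolutionOfSingularities.ResolutionOfSingularities.Theorems.WildQuotientsWildQuotientResolutionStubStableAffineCoverBlowup
import Summits.ResolutionOfSingularities.ResolutionOfSingularities.Theorems.WildQuotientsGaloisQuotientStableCover

/-!
# Terminal blow-ups of affine `G`-schemes over a field: the full model-side package
(crux stmt-ResolutionOfSingularities-15640 `WildQuotients.WildQuotientResolution`, line `Sketch`;
chain w45c rung LSB of `L/w45c/CHAIN.md` v3 — the generic form behind `TwoBlocks`/`NBlocks`)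

[OURS · L1 W4.5c; NOT a statement of the manuscript.] `TerminalBlowup.liftAction_terminal_spec`:
let a FINITE group `G` act by `k`-algebra automorphisms on a Noetherian `k`-algebra `B`
(`MulSemiringAction`, `SMulCommClass G k B`), `ρ g = Spec (g⁻¹)` the induced action on `Spec B`
(the law of `AffineQuotient.exists_specAction`), `I = (c_1, …, c_n) ⊆ B` a `G`-stable ideal, and
`π : V → Spec B` ANY blow-up along the ideal sheaf of `I` (`IsBlowup`). Suppose every `g ∈ G`
EITHER acts trivially on `B` OR has `I` as augmentation ideal with `g`-invariant generators
(`g • c_j = c_j`, `g • b - b ∈ I`, `c_j ∈ ⟨g • b - b⟩`). Then the lifted action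
`ρV = IsBlowup.liftAction` satisfies the three model-side clauses of
`CyclicTransfer.cyclicDivisorialTransfer_of_card` / `CyclicDivisorialModelsLE`: `π` is
equivariant, `V` is covered by `G`-stable affine opens
(`StableAffineCoverBlowup.stub_stableAffineCoverBlowup` over `Spec B → Spec k`), and at every
fixed point of every `ρV g` the stalk augmentation ideal is principal (zero for trivial `g`,
the lift of the identity being the identity; `isPrincipal_stalkAug_liftAction_spec` otherwise).
The instances `TwoBlocks.twoBlocks_liftAction_terminal` (p470436) and
`NBlocks.nBlocks_terminalModel` (p470928) are this statement for `σ = J₂ ⊕ J₂` and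
`σ = J₂^{⊕n}`; rung LSB (blocks ≤ 2 in arbitrary coordinates) is the next consumer.
-/

-- single-problem summit: the doubled namespace component `ResolutionOfSingularities` is forced
set_option linter.dupNamespace false

noncomputable section

open CategoryTheory AlgebraicGeometry TopologicalSpace
open Literature.AlgebraicGeometry.Resolution

namespace Summit.ResolutionOfSingularities.ResolutionOfSingularities.Theorems.WildQuotientResolution.TerminalBlowup


/-- **Terminal blow-up of an affine `G`-scheme over a field (model-side package; universe `0`, where the
quotient glue lives).** Let `G` be
a finite group acting on the Noetherian `k`-algebra `B` by `k`-algebra automorphisms, `ρ` the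
action `g ↦ Spec (g⁻¹)` on `Spec B`, `I = (c_j)` a `G`-stable ideal, and `π : V → Spec B` a
blow-up along its ideal sheaf. If every `g ∈ G` either acts trivially on `B` or satisfies
`g • c_j = c_j` (all `j`), `g • b - b ∈ I` (all `b`) and `c_j ∈ ⟨g • b - b : b⟩` (all `j`), then
for `ρV = IsBlowup.liftAction ρ`: (i) `ρV g ≫ π = π ≫ ρ g`; (ii) every point of `V` has a
`G`-stable affine open neighbourhood; (iii) at every point `v` fixed by `ρV g` the ideal
`⟨(stalkSpecializes ≫ (ρV g)^♯_v) s - s⟩` is principal. [folklore; assembly of landed decls] -/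
theorem liftAction_terminal_spec {k : Type} [Field k] {B : Type} [CommRing B] [Algebra k B]
    [IsNoetherianRing B] {G : Type} [Group G] [Finite G] [MulSemiringAction G B]
    [SMulCommClass G k B]
    (ρ : G →* Aut (Spec (CommRingCat.of B)))
    (hρ : ∀ g : G, (ρ g).hom =
      Spec.map (CommRingCat.ofHom ((MulSemiringAction.toRingEquiv G B g⁻¹ : B ≃+* B) : B →+* B)))
    (I : Ideal B) (hI : ∀ (g : G) (b : B), b ∈ I → g • b ∈ I)
    {n : ℕ} (cB : Fin n → B) (hcI : Ideal.span (Set.range cB) = I)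
    (hgen : ∀ g : G, (∀ b : B, g • b = b) ∨
      ((∀ j, g • cB j = cB j) ∧ (∀ b : B, g • b - b ∈ I) ∧
        ∀ j, cB j ∈ Ideal.span (Set.range fun b : B => g • b - b)))
    {V : Scheme.{0}} {π : V ⟶ Spec (CommRingCat.of B)}
    (hπ : IsBlowup π (affineBlowup.idealSheaf I)) :
    ∃ ρV : G →* Aut V,
      (∀ g, (ρV g).hom ≫ π = π ≫ (ρ g).hom) ∧
      (∀ v : V, ∃ W : V.Opens, IsAffineOpen W ∧ v ∈ W ∧ ∀ g, (ρV g).hom ⁻¹ᵁ W = W) ∧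
      ∀ (g : G) (v : V) (hv : (ρV g).hom.base v = v),
        (Ideal.span (Set.range fun s : V.presheaf.stalk v =>
          (V.presheaf.stalkSpecializes (specializes_of_eq hv) ≫ (ρV g).hom.stalkMap v).hom s -
            s)).IsPrincipal := by
  classical
  have hJ : ∀ g : G, (affineBlowup.idealSheaf I).comap (ρ g).hom = affineBlowup.idealSheaf I :=
    fun g => idealSheaf_comap_specAction ρ hρ I hI g
  refine ⟨hπ.liftAction ρ hJ, fun g => hπ.liftAction_hom_comp ρ hJ g, ?_, ?_⟩
  · -- Mumford's hypothesis, over `Spec B → Spec k`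
    intro v
    let q : Spec (CommRingCat.of B) ⟶ Spec (CommRingCat.of k) :=
      Spec.map (CommRingCat.ofHom (algebraMap k B))
    haveI : IsAffineHom q := isAffineHom_of_isAffine_of_isSeparated q
    have hρq : ∀ g : G, (ρ g).hom ≫ q = q := by
      intro g
      simp only [q, hρ, ← Spec.map_comp, ← CommRingCat.ofHom_comp]
      congr 2
      refine RingHom.ext fun c => ?_
      change (MulSemiringAction.toRingEquiv _ _ g⁻¹) (algebraMap k _ c) = algebraMap k _ c
      rw [MulSemiringAction.toRingEquiv_apply_apply, smul_algebraMap]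
    exact StableAffineCoverBlowup.stub_stableAffineCoverBlowup q ρ hρq hπ (hπ.liftAction ρ hJ)
      (fun g => hπ.liftAction_hom_comp ρ hJ g) v
  · -- the divisorial clause
    intro g v hv
    rcases hgen g with htriv | ⟨hfix, haug, hcmem⟩
    · -- `g` acts trivially: the lift is the identity, the ideal is zero
      have hρg : (ρ g).hom = 𝟙 _ := by
        rw [hρ]
        have : ((MulSemiringAction.toRingEquiv G B g⁻¹ : B ≃+* B) : B →+* B) = RingHom.id _ := by
          refine RingHom.ext fun b => ?_
          change (MulSemiringAction.toRingEquiv _ _ g⁻¹) b = b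
          rw [MulSemiringAction.toRingEquiv_apply_apply, inv_smul_eq_iff, htriv]
        rw [this, CommRingCat.ofHom_id, Spec.map_id]
      have hlift : (hπ.liftAction ρ hJ g).hom = 𝟙 _ :=
        hπ.eq_id_of_comp_eq (by rw [hπ.liftAction_hom_comp, hρg, Category.comp_id])
      have key : ∀ (f : V ⟶ V) (_ : f = 𝟙 V) (hvf : f.base v = v),
          Ideal.span (Set.range fun s : V.presheaf.stalk v =>
            (V.presheaf.stalkSpecializes (specializes_of_eq hvf) ≫ f.stalkMap v).hom s - s) = ⊥ := by
        intro f hf hvf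
        subst hf
        refine Ideal.span_eq_bot.mpr ?_
        rintro _ ⟨s, rfl⟩
        change ((𝟙 V : V ⟶ V).stalkMap v).hom
          ((V.presheaf.stalkSpecializes (specializes_of_eq hvf)).hom s) - s = 0
        erw [Scheme.Hom.stalkMap_id]
        rw [sub_eq_zero]
        exact stalkSpecializes_self_apply V.presheaf v _ s
      rw [key _ hlift hv]
      exact bot_isPrincipal
    · exact isPrincipal_stalkAug_liftAction_spec ρ hρ I hπ hJ g cB hcI hfix haug hcmem v hv

end Summit.ResolutionOfSingularities.ResolutionOfSingularities.Theorems.WildQuotientResolution.TerminalBlowup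

end
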